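import Summits.CriticalPhenomena.PercolationContinuityZ3.Theorems.PercNearOneGluingNoHeavyLowerTailSahiMixtureChainBernstein
import Summits.CriticalPhenomena.PercolationContinuityZ3.Theorems.PercNearOneGluingNoHeavyLowerTailSahiMixtureMonotone
import HarnessLib

/-!
# `E_n` on a chain is Bernstein-positive between ANY two weights; the BOTTOM (AND-coin) cell of every monotone mixture
# of product measures is Bernstein-positive at every order

Support file of the one-cut programme (crux `NoHeavyLowerTail`, stmt-CriticalPhenomena-4575; cell `prim-masterthm`, seat P3, gen 15;
`run/shared/lean/prim/prim-masterthm/prim-masterthm-p3/HIERARCHY.md` §23; memo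
`run/shared/lean/prim/prim-masterthm/FROM-prim-masterthm-p3-g15-MONOTONE-MIXTURES.md` §2–§3).

THE TWO-WEIGHT CHAIN THEOREM (`bernsteinPos_sahiE_mixWeights_of_linearOrder`).  On a finite chain, for ANY two probability weights `ν₀, ν₁`, every `n` and
all nonnegative monotone `f_0,…,f_{n−1}`, `h ↦ E_n^{(1−h)ν₀ + hν₁}(f)` is Bernstein-positive of degree `n`.  (Equivalently: the homogenised `E_n` of a chain is
a form with NONNEGATIVE coefficients in the weight — the polar values of `E_n` at point masses of a chain are the nonnegative numbers of the product formula; memo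
§2 "NCP".)  Proof as in `…SahiMixtureChainBernstein` (the case `ν₁ = δ_top`): layer cake, sorting, and the product formula, whose factors
`(k−i) − ((1−h)ν₀(U_i) + hν₁(U_i)) = (1−h)((k−i) − ν₀(U_i)) + h((k−i) − ν₁(U_i))` and `(1−h)ν₀(U_k) + hν₁(U_k)` are affine in `h` with nonnegative endpoints.

CONSEQUENCES (uniform in the order): **`bernsteinPos_andCoin_all_of_chainMoments`** — for events with chain moments (conditionally independent given a latent
level, co-monotone conditional probabilities), AND-ing an independent coin into ALL members gives a Bernstein-positive coin polynomial
`h ↦ E_m(μ ⊗ coin(h); 1_{A∩H},…)` of degree `m`, every `m` (the coin "off" is a new BOTTOM level `y ≡ 0`); instance **`bernsteinPos_andCoin_all_of_monotoneMixture`**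
for `mixProdWeight`.  With `…SahiMixtureMonotoneTop` this gives both extreme rungs (TOP = OR into all, BOTTOM = AND into all) of the mixture ladder on the
class at every order.
HONEST FRAMING: nothing here asserts (M⁺-k) or `C_k` for `k ≥ 3`; partial cells (`|G| < m`) and general increasing events are not covered.
Everything PROVED, standard axioms, definition-free except for the use of `mixProdWeight`/`bitEv` of `…SahiMixtureMonotone`. [this work]
-/

noncomputable section

open scoped Classical

namespace Summit.CriticalPhenomena.PercolationContinuityZ3.Theorems

open Finset Function
open Literature.Combinatorics.Sahi2008
open Literature.Probability.Percolation.DecisionTree (ind ind_of_mem ind_of_not_mem ind_nonneg)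

namespace SahiMixture

/-! ### The two-weight chain theorem -/

section Chain

variable {α : Type*} [Fintype α] [LinearOrder α]

omit [LinearOrder α] in
/-- Expectation under the mixed weight `(1−h)ν₀ + hν₁`. [folklore] -/
theorem ex_mixWeights (ν₀ ν₁ : α → ℝ) (h : ℝ) (f : α → ℝ) :
    ex (fun x => (1 - h) * ν₀ x + h * ν₁ x) f = (1 - h) * ex ν₀ f + h * ex ν₁ f := by
  simp only [ex_def, add_mul, Finset.sum_add_distrib, mul_assoc, ← Finset.mul_sum]

/-- **Indicator case**: for up-sets `U_0,…,U_n` of a finite chain and two probability weights, `h ↦ E_{n+1}^{(1−h)ν₀ + hν₁}(1_{U_0},…,1_{U_n})` is Bernstein-positive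
of degree `n+1` (product formula on the sorted family; affine factors with nonnegative endpoints). [this work] -/
theorem bernsteinPos_sahiE_mixWeights_setInd (ν₀ ν₁ : α → ℝ) (h00 : ∀ x, 0 ≤ ν₀ x) (h01 : ∑ x, ν₀ x = 1)
    (h10 : ∀ x, 0 ≤ ν₁ x) (h11 : ∑ x, ν₁ x = 1) (n : ℕ) (U : Fin (n + 1) → Finset α) (hU : ∀ i, IsUpperSet ((U i : Finset α) : Set α)) :
    BernsteinPos (n + 1) (fun h => sahiE (fun x => (1 - h) * ν₀ x + h * ν₁ x) (n + 1) (fun i => setInd (U i))) := by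
  have htot : ∀ i j, U i ⊆ U j ∨ U j ⊆ U i := fun i j => by
    rcases (hU i).total (hU j) with h | h
    · exact Or.inl (Finset.coe_subset.1 h)
    · exact Or.inr (Finset.coe_subset.1 h)
  obtain ⟨σ, hσ⟩ := exists_perm_antitone_of_total U htot
  have hperm : ∀ μ : α → ℝ, sahiE μ (n + 1) (fun i => setInd (U i)) = sahiE μ (n + 1) (fun i => setInd (U (σ i))) :=
    fun μ => (sahiE_comp_perm μ (n + 1) σ (fun i => setInd (U i))).symm
  have habs : ∀ i j : Fin (n + 1), i < j → setInd (U (σ j)) * setInd (U (σ i)) = setInd (U (σ j)) := by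
    intro i j hij
    rw [setInd_mul, Finset.inter_eq_left.2 (hσ i j hij.le)]
  have hle : ∀ (ν : α → ℝ), (∀ x, 0 ≤ ν x) → ∑ x, ν x = 1 → ∀ i, 0 ≤ ex ν (setInd (U (σ i))) ∧ ex ν (setInd (U (σ i))) ≤ 1 := by
    intro ν hν0 hν1 i
    refine ⟨ex_nonneg hν0 fun x => setInd_nonneg _ _, ?_⟩
    calc ex ν (setInd (U (σ i))) ≤ ex ν (fun _ => (1 : ℝ)) := ex_mono hν0 fun x => by
            rw [setInd_apply]; split_ifs <;> norm_num
      _ = 1 := ex_const hν1 1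
  have hfac : BernsteinPos n (fun h => ∏ i : Fin n,
      (((n : ℝ) - (i : ℕ)) - ((1 - h) * ex ν₀ (setInd (U (σ i.castSucc))) + h * ex ν₁ (setInd (U (σ i.castSucc)))))) := by
    refine BernsteinPos.finProd n _ fun i => ?_
    have hi : ((i : ℕ) : ℝ) + 1 ≤ (n : ℝ) := by exact_mod_cast Nat.succ_le_of_lt i.isLt
    have h0 := (hle ν₀ h00 h01 i.castSucc).2
    have h1 := (hle ν₁ h10 h11 i.castSucc).2
    refine (bernsteinPos_affine (x := (n : ℝ) - (i : ℕ) - ex ν₀ (setInd (U (σ i.castSucc))))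
      (y := (n : ℝ) - (i : ℕ) - ex ν₁ (setInd (U (σ i.castSucc)))) (by linarith) (by linarith)).congr fun h _ _ => ?_
    ring
  have hlast : BernsteinPos 1 (fun h => (1 - h) * ex ν₀ (setInd (U (σ (Fin.last n)))) + h * ex ν₁ (setInd (U (σ (Fin.last n))))) :=
    bernsteinPos_affine (hle ν₀ h00 h01 (Fin.last n)).1 (hle ν₁ h10 h11 (Fin.last n)).1
  refine (BernsteinPos.mul hfac hlast).congr fun h _ _ => ?_
  rw [hperm, sahiE_chain _ n (fun i => setInd (U (σ i))) habs]
  simp only [ex_mixWeights]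

/-- Slot-by-slot layer cake behind the two-weight chain theorem. [this work] -/
theorem bernsteinPos_sahiE_mixWeights_aux (ν₀ ν₁ : α → ℝ) (h00 : ∀ x, 0 ≤ ν₀ x) (h01 : ∑ x, ν₀ x = 1)
    (h10 : ∀ x, 0 ≤ ν₁ x) (h11 : ∑ x, ν₁ x = 1) (n : ℕ) :
    ∀ (m : ℕ) (f : Fin (n + 1) → α → ℝ), (∀ i x, 0 ≤ f i x) → (∀ i, Monotone (f i)) →
      (∀ i : Fin (n + 1), m ≤ i.val → ∃ U : Finset α, IsUpperSet ((U : Finset α) : Set α) ∧ f i = setInd U) →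
      BernsteinPos (n + 1) (fun h => sahiE (fun x => (1 - h) * ν₀ x + h * ν₁ x) (n + 1) f)
  | 0, f, _, _, hind => by
    choose U hU hfU using fun i => hind i (Nat.zero_le _)
    have hf : f = fun i => setInd (U i) := funext hfU
    rw [hf]
    exact bernsteinPos_sahiE_mixWeights_setInd ν₀ ν₁ h00 h01 h10 h11 n U hU
  | m + 1, f, hf, hmono, hind => by
    by_cases hm : m < n + 1
    · let i : Fin (n + 1) := ⟨m, hm⟩
      obtain ⟨l, hl, hfl⟩ := exists_upperSet_decomposition (f i) (hf i) (hmono i)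
      have key := bernsteinPos_listSum (m := n + 1)
        (fun (V : Finset α) (h : ℝ) => sahiE (fun x => (1 - h) * ν₀ x + h * ν₁ x) (n + 1) (update f i (setInd V))) l ?_
      · refine key.congr fun h _ _ => ?_
        show sahiE _ (n + 1) f = _
        conv_lhs => rw [← update_eq_self i f, hfl]
        rw [sahiE_update_listSum]
      · intro p hp
        refine ⟨(hl p hp).1, bernsteinPos_sahiE_mixWeights_aux ν₀ ν₁ h00 h01 h10 h11 n m _ ?_ ?_ ?_⟩
        · intro j x
          by_cases hji : j = i
          · subst hji; rw [update_self]; exact setInd_nonneg _ _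
          · rw [update_of_ne hji]; exact hf j x
        · intro j
          by_cases hji : j = i
          · subst hji; rw [update_self]; exact monotone_setInd (hl p hp).2
          · rw [update_of_ne hji]; exact hmono j
        · intro j hmj
          by_cases hji : j = i
          · subst hji
            exact ⟨p.2, (hl p hp).2, by rw [update_self]⟩
          · have hij : m + 1 ≤ j.val := by
              have : j.val ≠ m := fun hv => hji (Fin.ext hv)
              omega
            obtain ⟨U, hU, hjU⟩ := hind j hij
            exact ⟨U, hU, by rw [update_of_ne hji]; exact hjU⟩
    · exact bernsteinPos_sahiE_mixWeights_aux ν₀ ν₁ h00 h01 h10 h11 n m f hf hmono fun i hi => absurd hi (by omega)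

/-- **The two-weight chain theorem.**  On a finite chain, for any two probability weights `ν₀, ν₁`, every `n` and all nonnegative monotone `f_0,…,f_{n−1}`,
`h ↦ E_n^{(1−h)ν₀ + hν₁}(f_0,…,f_{n−1})` is Bernstein-positive of degree `n`. [this work] -/
theorem bernsteinPos_sahiE_mixWeights_of_linearOrder (ν₀ ν₁ : α → ℝ) (h00 : ∀ x, 0 ≤ ν₀ x) (h01 : ∑ x, ν₀ x = 1)
    (h10 : ∀ x, 0 ≤ ν₁ x) (h11 : ∑ x, ν₁ x = 1) (n : ℕ) (f : Fin n → α → ℝ) (hf : ∀ i x, 0 ≤ f i x) (hmono : ∀ i, Monotone (f i)) :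
    BernsteinPos n (fun h => sahiE (fun x => (1 - h) * ν₀ x + h * ν₁ x) n f) := by
  rcases n with _ | n
  · simpa [sahiE_zero] using bernsteinPos_const 0 le_rfl
  · exact bernsteinPos_sahiE_mixWeights_aux ν₀ ν₁ h00 h01 h10 h11 n (n + 1) f hf hmono fun i hi => absurd hi (by omega)

end Chain

/-! ### The BOTTOM (AND-coin) cell under chain moments, every order -/

section AndCoin

variable {α : Type*} [Fintype α] {L n : ℕ}

/-- Moments of the all-members AND-coin family under `μ ⊗ coin(h)`: `E[Π_{r<k} 1_{A_{e r} ∩ H}] = (1 − h)·0^k + h·E[Π_r 1_{A_{e r}}]`. [this work] -/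
theorem ex_coinWeight_prod_ind_andCoin_all (μ : α → ℝ) (hμ1 : ∑ a, μ a = 1) (A : Fin n → Set α) (h : ℝ) {k : ℕ}
    (e : Fin k → Fin n) :
    ex (coinWeight μ h) (∏ r, ind (andCoin (A (e r)) true)) = (1 - h) * (0 : ℝ) ^ k + h * ex μ (∏ r, ind (A (e r))) := by
  rw [ex_coinWeight]
  have hf : (fun a : α => (∏ r, ind (andCoin (A (e r)) true)) (a, false)) = fun _ => (0 : ℝ) ^ k := by
    funext a
    rw [Finset.prod_apply]
    simp only [ind_andCoin_false, cond_true, Finset.prod_const, Finset.card_univ, Fintype.card_fin]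
  have ht : (fun a : α => (∏ r, ind (andCoin (A (e r)) true)) (a, true)) = ∏ r, ind (A (e r)) := by
    funext a
    rw [Finset.prod_apply, Finset.prod_apply]
    exact Finset.prod_congr rfl fun r _ => ind_andCoin_true _ _ _
  rw [hf, ht, ex_const hμ1]

/-- **Bernstein positivity of the all-members AND-coin cell under chain moments, every order.**  With chain moments `E[Π_r 1_{A_{e r}}] = Σ_l w_l Π_r y_{l,e r}`
(`w ≥ 0` of mass `1`, `y ≥ 0`, `y_{·,i}` nondecreasing), for `h ∈ [0,1]`, every `m` and every injective `s`:
`h ↦ E_m(μ ⊗ coin(h); 1_{A_{s 0} ∩ H},…,1_{A_{s(m−1)} ∩ H})` is Bernstein-positive of degree `m` (the coin "off" is a new BOTTOM level `y ≡ 0`: the chain theorem for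
the weights `δ_bottom` and `(0,w)` on `Fin (L+1)`). [this work] -/
theorem bernsteinPos_andCoin_all_of_chainMoments (μ : α → ℝ) (hμ1 : ∑ a, μ a = 1) (A : Fin n → Set α)
    (w : Fin L → ℝ) (hw0 : ∀ l, 0 ≤ w l) (hw1 : ∑ l, w l = 1)
    (y : Fin L → Fin n → ℝ) (hy0 : ∀ l i, 0 ≤ y l i) (hmono : ∀ i, Monotone (fun l => y l i))
    (hmom : ∀ (k : ℕ) (e : Fin k → Fin n), Function.Injective e →
      ex μ (∏ r, ind (A (e r))) = ∑ l, w l * ∏ r, y l (e r))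
    {m : ℕ} (s : Fin m → Fin n) (hs : Function.Injective s) :
    BernsteinPos m (fun h => sahiE (coinWeight μ h) m (fun j => ind (andCoin (A (s j)) true))) := by
  -- the chain `Fin (L+1)` with a new bottom level `0`: weights `δ_0` (coin off) and `(0, w)` (coin on); functions `Fin.cons 0 (l ↦ y l (s j))`
  let ν₀ : Fin (L + 1) → ℝ := Fin.cons 1 (fun _ => 0)
  let ν₁ : Fin (L + 1) → ℝ := Fin.cons 0 w
  let g : Fin m → Fin (L + 1) → ℝ := fun j => Fin.cons 0 (fun l => y l (s j))
  have h00 : ∀ a, 0 ≤ ν₀ a := fun a => by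
    refine Fin.cases ?_ (fun l => ?_) a
    · simp only [ν₀, Fin.cons_zero]; exact zero_le_one
    · simp only [ν₀, Fin.cons_succ]; exact le_rfl
  have h01 : ∑ a, ν₀ a = 1 := by simp [ν₀, Fin.sum_univ_succ]
  have h10 : ∀ a, 0 ≤ ν₁ a := fun a => by
    refine Fin.cases ?_ (fun l => ?_) a
    · simp only [ν₁, Fin.cons_zero]; exact le_rfl
    · simp only [ν₁, Fin.cons_succ]; exact hw0 l
  have h11 : ∑ a, ν₁ a = 1 := by simp [ν₁, Fin.sum_univ_succ, hw1]
  have hg0 : ∀ j a, 0 ≤ g j a := fun j a => by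
    refine Fin.cases ?_ (fun l => ?_) a
    · simp only [g, Fin.cons_zero]; exact le_rfl
    · simp only [g, Fin.cons_succ]; exact hy0 l (s j)
  have hgm : ∀ j, Monotone (g j) := by
    intro j a b hab
    refine Fin.cases ?_ (fun a' => ?_) a hab
    · intro _; simp only [g, Fin.cons_zero]; exact hg0 j b
    · intro hab'
      rcases Fin.eq_zero_or_eq_succ b with rfl | ⟨b', rfl⟩
      · exact absurd hab' (not_le.2 (Fin.succ_pos a'))
      · simp only [g, Fin.cons_succ]; exact hmono (s j) (Fin.succ_le_succ_iff.1 hab')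
  have key := bernsteinPos_sahiE_mixWeights_of_linearOrder ν₀ ν₁ h00 h01 h10 h11 m g hg0 hgm
  refine key.congr fun h _ _ => ?_
  refine sahiE_congr_of_moments (coinWeight μ h) _ (fun j => ind (andCoin (A (s j)) true)) g ?_
  intro k e he
  rw [show (∏ r, ind (andCoin (A (s (e r))) true)) = ∏ r, ind (andCoin (A ((s ∘ e) r)) true) from rfl,
    ex_coinWeight_prod_ind_andCoin_all μ hμ1 A h (s ∘ e), hmom k (s ∘ e) (hs.comp he), ex_mixWeights, ex_def, ex_def,
    Fin.sum_univ_succ, Fin.sum_univ_succ]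
  simp only [ν₀, ν₁, g, Fin.cons_zero, Fin.cons_succ, Finset.prod_apply, Function.comp, Finset.prod_const, Finset.card_univ,
    Fintype.card_fin, zero_mul, Finset.sum_const_zero, add_zero, one_mul, zero_add, Finset.mul_sum]

/-- **Instance: the BOTTOM (AND-coin) cell of a monotone mixture of product measures is Bernstein-positive at every order.** [this work] -/
theorem bernsteinPos_andCoin_all_of_monotoneMixture {ι : Type*} [Fintype ι] [DecidableEq ι]
    (w : Fin L → ℝ) (hw0 : ∀ l, 0 ≤ w l) (hw1 : ∑ l, w l = 1)
    (y : Fin L → ι → ℝ) (hy0 : ∀ l i, 0 ≤ y l i) (hmono : ∀ i, Monotone (fun l => y l i))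
    {m : ℕ} (e : Fin m → ι) (he : Function.Injective e) :
    BernsteinPos m (fun h => sahiE (coinWeight (mixProdWeight w y) h) m (fun j => ind (andCoin (bitEv (e j)) true))) := by
  have hμ1 : ∑ x, mixProdWeight w y x = 1 := by rw [sum_mixProdWeight, hw1]
  exact bernsteinPos_andCoin_all_of_chainMoments (mixProdWeight w y) hμ1 (fun j => bitEv (e j)) w hw0 hw1 (fun l j => y l (e j))
    (fun l j => hy0 l (e j)) (fun j => hmono (e j))
    (fun _ e' he' => ex_mixProdWeight_prod_ind w y (e ∘ e') (he.comp he')) id injective_id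

end AndCoin

end SahiMixture

end Summit.CriticalPhenomena.PercolationContinuityZ3.Theorems

end
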